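import Mathlib

/-!
# The exponentially convergent trapezoidal rule on the real line (Trefethen–Weideman)

For a function `w` holomorphic in the strip `|Im z| < a`, tending to zero uniformly as
`|Re z| → ∞` in the strip and with `∫ |w(x + ib)| dx ≤ M` for all `|b| < a`, the trapezoidal rule
`I_h = h Σ_{k ∈ ℤ} w(kh)` satisfies `|I_h - ∫_ℝ w| ≤ 2M / (e^{2πa/h} - 1)`
([cite: TrefethenWeideman2014, Thm. 5.1]; this is Thm. 5.1 of the published SIAM Review version,
numbered Thm. 6.1 in the Oxford technical report NA-13-15 of the same paper).  The constant `2M`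
is best possible (loc. cit.; not formalised).

The proof is the authors' "proof by Fourier transform and aliasing": the Fourier transform of
`w|_ℝ` decays like `M e^{-2π a' |ξ|}` for every `a' < a` by shifting the line of integration
(a Paley–Wiener bound), and the Poisson summation formula turns the trapezoidal sum into the sum
of the Fourier transform over the dual lattice.  We use Mathlib's Poisson summation formula
`Real.tsum_eq_tsum_fourier_of_rpow_decay_of_summable`, which asks for a polynomial decay
`w(x) = O(|x|^{-b})`, `b > 1`, of `w` on the real axis; this hypothesis (`hdec`) is therefore
added to the published statement (it holds for every integrand the double-exponential and
sinc quadrature rules are applied to, and it makes the series `Σ w(kh)` absolutely convergent).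

Engine use: this is the strip bound behind the `h Σ w(kh)` (DE / tanh-sinh) lane of
`certquad` / `cap.quad1d` in the engines tree; rigour of any published number stays with the
client cell's verifiers.
-/

open Complex MeasureTheory Filter Set Topology Asymptotics
open scoped Interval Real

namespace Literature.Analysis.Quadrature

/-- Shifting the line of integration inside a strip of analyticity: if `g` is holomorphic on the
open strip `|Im z| < a`, tends to zero uniformly as `|Re z| → ∞` there, and is integrable on the two
horizontal lines `Im z = 0` and `Im z = c` (`|c| < a`), then the two line integrals agree
(Cauchy's theorem on the rectangles `[-R, R] × [0, c]`, `R → ∞`; the step "the assumption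
`w(x) → 0` in the strip ensures that this shift does not change the value" of the cited proof).
[folklore] -/
private theorem integral_add_mul_I_eq_integral {g : ℂ → ℂ} {a c : ℝ} (hc : |c| < a)
    (hg : DifferentiableOn ℂ g {z : ℂ | |z.im| < a})
    (h0 : Integrable fun x : ℝ => g x) (h1 : Integrable fun x : ℝ => g (x + c * I))
    (hvan : ∀ ε > 0, ∃ R : ℝ, ∀ z : ℂ, |z.im| < a → R ≤ |z.re| → ‖g z‖ ≤ ε) :
    ∫ x : ℝ, g (x + c * I) = ∫ x : ℝ, g x := by
  -- the rectangle identity for every half-width `R`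
  have key : ∀ R : ℝ, (∫ x in -R..R, g x) - (∫ x in -R..R, g (x + c * I)) =
      -(I • ∫ y in (0:ℝ)..c, g (R + y * I)) + I • ∫ y in (0:ℝ)..c, g (-R + y * I) := by
    intro R
    have hd : DifferentiableOn ℂ g ([[((-R : ℝ) : ℂ).re, ((R : ℂ) + c * I).re]] ×ℂ
        [[((-R : ℝ) : ℂ).im, ((R : ℂ) + c * I).im]]) := by
      refine hg.mono fun z hz => ?_
      rw [mem_reProdIm] at hz
      simp only [ofReal_neg, neg_re, ofReal_re, add_re, mul_re, I_re, mul_zero, ofReal_im,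
        I_im, mul_one, sub_self, add_zero, neg_im, neg_zero, add_im, mul_im, zero_add] at hz
      simp only [mem_setOf_eq]
      have h2 : |z.im| ≤ |c| := by
        rcases hz with ⟨-, hz⟩
        rcases le_total 0 c with h | h
        · rw [uIcc_of_le h] at hz; rw [abs_of_nonneg h, abs_le]
          constructor <;> linarith [hz.1, hz.2]
        · rw [uIcc_of_ge h] at hz; rw [abs_of_nonpos h, abs_le]
          constructor <;> linarith [hz.1, hz.2]
      exact lt_of_le_of_lt h2 hc
    have := Complex.integral_boundary_rect_eq_zero_of_differentiableOn g ((-R : ℝ) : ℂ)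
      ((R : ℂ) + c * I) hd
    simp only [ofReal_neg, neg_re, ofReal_re, add_re, mul_re, I_re, mul_zero, ofReal_im,
      I_im, mul_one, sub_self, add_zero, neg_im, neg_zero, add_im, mul_im, zero_add,
      ofReal_zero, zero_mul] at this
    linear_combination this
  -- the left side tends to the difference of the two line integrals
  have hL : Tendsto (fun R : ℝ => (∫ x in -R..R, g x) - ∫ x in -R..R, g (x + c * I)) atTop
      (𝓝 ((∫ x : ℝ, g x) - ∫ x : ℝ, g (x + c * I))) :=
    (intervalIntegral_tendsto_integral h0 tendsto_neg_atTop_atBot tendsto_id).sub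
      (intervalIntegral_tendsto_integral h1 tendsto_neg_atTop_atBot tendsto_id)
  -- each vertical side is small once `R` is large
  have side : ∀ ε > 0, ∃ R₀ : ℝ, ∀ s : ℝ, R₀ ≤ |s| →
      ‖I • ∫ y in (0:ℝ)..c, g (s + y * I)‖ ≤ ε * |c| := by
    intro ε hε
    obtain ⟨R₀, hR₀⟩ := hvan ε hε
    refine ⟨R₀, fun s hs => ?_⟩
    rw [norm_smul, norm_I, one_mul]
    have := intervalIntegral.norm_integral_le_of_norm_le_const (a := (0:ℝ)) (b := c) (C := ε)
      (f := fun y : ℝ => g (s + y * I)) ?_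
    · simpa only [sub_zero] using this
    · intro y hy
      apply hR₀
      · have him : ((s : ℂ) + y * I).im = y := by simp
        rw [him]
        have : |y| ≤ |c| := by
          rcases le_total 0 c with h | h
          · rw [uIoc_of_le h] at hy; rw [abs_of_nonneg h, abs_of_nonneg hy.1.le]; exact hy.2
          · rw [uIoc_of_ge h] at hy; rw [abs_of_nonpos h, abs_of_nonpos hy.2]; linarith [hy.1]
        exact lt_of_le_of_lt this hc
      · have hre : ((s : ℂ) + y * I).re = s := by simp
        rw [hre]; exact hs
  -- hence the left side tends to zero as well
  have hR : Tendsto (fun R : ℝ => (∫ x in -R..R, g x) - ∫ x in -R..R, g (x + c * I)) atTop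
      (𝓝 0) := by
    rw [NormedAddGroup.tendsto_nhds_zero]
    intro ε hε
    obtain ⟨R₀, hR₀⟩ := side (ε / (2 * (|c| + 1))) (by positivity)
    filter_upwards [eventually_ge_atTop (max R₀ 0)] with R hR
    have hR0 : 0 ≤ R := le_trans (le_max_right _ _) hR
    have hR1 : R₀ ≤ R := le_trans (le_max_left _ _) hR
    rw [key R]
    have e1 := hR₀ R (by rwa [abs_of_nonneg hR0])
    have e2 := hR₀ (-R) (by rwa [abs_neg, abs_of_nonneg hR0])
    push_cast at e2
    calc ‖-(I • ∫ y in (0:ℝ)..c, g (R + y * I)) + I • ∫ y in (0:ℝ)..c, g (-R + y * I)‖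
        ≤ ‖I • ∫ y in (0:ℝ)..c, g (R + y * I)‖ + ‖I • ∫ y in (0:ℝ)..c, g (-R + y * I)‖ := by
          refine (norm_add_le _ _).trans ?_; rw [norm_neg]
      _ ≤ ε / (2 * (|c| + 1)) * |c| + ε / (2 * (|c| + 1)) * |c| := add_le_add e1 e2
      _ = ε * (|c| / (|c| + 1)) := by field_simp; ring
      _ < ε := by
          have : |c| / (|c| + 1) < 1 := by
            rw [div_lt_one (by positivity)]; linarith
          calc ε * (|c| / (|c| + 1)) < ε * 1 := by gcongr
            _ = ε := mul_one ε
  have := tendsto_nhds_unique hL hR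
  exact (sub_eq_zero.mp this).symm

open scoped FourierTransform Real in
/-- Paley–Wiener type decay of the Fourier transform of the restriction to `ℝ` of a function
holomorphic in the strip `|Im z| < a`: shifting the line of integration to `Im z = c` gives
`‖𝓕 w ξ‖ ≤ e^{2π c ξ} ∫ ‖w (x + ic)‖ dx` (Mathlib's normalisation `𝓕 w ξ = ∫ e^{-2πixξ} w(x) dx`);
with `c = ∓a'` according to the sign of `ξ` and `∫ ‖w(x + ic)‖ ≤ M` this is the bound
`|ŵ(ξ)| ≤ M e^{-2πa'|ξ|}` of the cited proof ("this is the Paley–Wiener result"; eq. (6.11) of the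
report version NA-13-15, stated there in the normalisation `ŵ(ξ) = (1/2π) ∫ e^{-iξx} w`).
[cite: TrefethenWeideman2014, proof of Thm. 5.1] -/
theorem norm_fourier_le_exp_mul_integral {w : ℂ → ℂ} {a c : ℝ} (hc : |c| < a)
    (hw : DifferentiableOn ℂ w {z : ℂ | |z.im| < a})
    (h0 : Integrable fun x : ℝ => w x) (h1 : Integrable fun x : ℝ => w (x + c * I))
    (hvan : ∀ ε > 0, ∃ R : ℝ, ∀ z : ℂ, |z.im| < a → R ≤ |z.re| → ‖w z‖ ≤ ε) (ξ : ℝ) :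
    ‖𝓕 (fun x : ℝ => w x) ξ‖ ≤ Real.exp (2 * π * c * ξ) * ∫ x : ℝ, ‖w (x + c * I)‖ := by
  -- the integrand of the Fourier integral, as a holomorphic function on the strip
  set g : ℂ → ℂ := fun z => cexp (-2 * π * z * ξ * I) * w z with hg_def
  have hnexp : ∀ z : ℂ, ‖cexp (-2 * π * z * ξ * I)‖ = Real.exp (2 * π * ξ * z.im) := by
    intro z; rw [Complex.norm_exp]; congr 1; simp; ring
  have hF : 𝓕 (fun x : ℝ => w x) ξ = ∫ x : ℝ, g x := by
    rw [Real.fourier_real_eq_integral_exp_smul]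
    congr 1; ext x; simp only [hg_def, smul_eq_mul]; push_cast; ring_nf
  have hgd : DifferentiableOn ℂ g {z : ℂ | |z.im| < a} := by
    refine DifferentiableOn.mul ?_ hw
    exact (Complex.differentiable_exp.comp (by fun_prop)).differentiableOn
  -- integrability on the two lines
  have hint : ∀ (d : ℝ), Integrable (fun x : ℝ => w (x + d * I)) →
      Integrable fun x : ℝ => g (x + d * I) := by
    intro d hd
    refine hd.bdd_mul (c := Real.exp (2 * π * ξ * d)) (by fun_prop) (Eventually.of_forall ?_)
    intro x; rw [hnexp]; simp
  have hg0 : Integrable fun x : ℝ => g x := by simpa using hint 0 (by simpa using h0)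
  have hg1 : Integrable fun x : ℝ => g (x + c * I) := hint c h1
  -- uniform vanishing of `g`
  have hgvan : ∀ ε > 0, ∃ R : ℝ, ∀ z : ℂ, |z.im| < a → R ≤ |z.re| → ‖g z‖ ≤ ε := by
    intro ε hε
    obtain ⟨R, hR⟩ := hvan (ε * Real.exp (-(2 * π * |ξ| * a))) (by positivity)
    refine ⟨R, fun z hz hzR => ?_⟩
    rw [hg_def, norm_mul, hnexp]
    have h1 : Real.exp (2 * π * ξ * z.im) ≤ Real.exp (2 * π * |ξ| * a) := by
      rw [Real.exp_le_exp]
      have : ξ * z.im ≤ |ξ| * a := by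
        calc ξ * z.im ≤ |ξ * z.im| := le_abs_self _
          _ = |ξ| * |z.im| := abs_mul _ _
          _ ≤ |ξ| * a := by gcongr
      nlinarith [Real.pi_pos]
    calc Real.exp (2 * π * ξ * z.im) * ‖w z‖
        ≤ Real.exp (2 * π * |ξ| * a) * (ε * Real.exp (-(2 * π * |ξ| * a))) := by
          gcongr; exact hR z hz hzR
      _ = ε := by rw [Real.exp_neg]; field_simp
  -- shift the line and estimate
  rw [hF, ← integral_add_mul_I_eq_integral hc hgd hg0 hg1 hgvan]
  calc ‖∫ x : ℝ, g (x + c * I)‖ ≤ ∫ x : ℝ, ‖g (x + c * I)‖ := norm_integral_le_integral_norm _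
    _ = ∫ x : ℝ, Real.exp (2 * π * c * ξ) * ‖w (x + c * I)‖ := by
        congr 1; ext x; rw [hg_def, norm_mul, hnexp]; simp; left; ring
    _ = Real.exp (2 * π * c * ξ) * ∫ x : ℝ, ‖w (x + c * I)‖ := integral_const_mul _ _


open scoped FourierTransform in
/-- Scaling of the Fourier transform under `x ↦ x h` (private helper). [folklore] -/
private theorem fourier_mul_comp_mul (f : ℝ → ℂ) {h : ℝ} (hh : 0 < h) (ξ : ℝ) :
    𝓕 (fun x : ℝ => (h : ℂ) * f (x * h)) ξ = 𝓕 f (ξ * h⁻¹ * 1) := by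
  rw [mul_one, Real.fourier_real_eq_integral_exp_smul, Real.fourier_real_eq_integral_exp_smul]
  have e : (fun v : ℝ => cexp (↑(-2 * π * v * ξ) * I) • ((h : ℂ) * f (v * h))) =
      fun v : ℝ => (h : ℂ) • (fun u : ℝ => cexp (↑(-2 * π * u * (ξ * h⁻¹)) * I) • f u) (v * h) := by
    funext v
    simp only [smul_eq_mul]
    have : (-2 * π * v * ξ : ℝ) = -2 * π * (v * h) * (ξ * h⁻¹) := by field_simp
    rw [this]; ring
  rw [e, integral_smul, Measure.integral_comp_mul_right
    (fun u : ℝ => cexp (↑(-2 * π * u * (ξ * h⁻¹)) * I) • f u) h, abs_of_pos (inv_pos.mpr hh),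
    Complex.real_smul, smul_eq_mul, ← mul_assoc]
  rw [show (h : ℂ) * ((h⁻¹ : ℝ) : ℂ) = 1 by
    push_cast; exact mul_inv_cancel₀ (by exact_mod_cast hh.ne'), one_mul]

open scoped FourierTransform in
/-- **Trefethen–Weideman, Theorem 5.1** (the exponentially convergent trapezoidal rule on `ℝ`).
Let `w` be holomorphic in the strip `|Im z| < a` (`a > 0`), tend to `0` uniformly as `|Re z| → ∞`
in the strip, and satisfy `∫ |w(x + iy)| dx ≤ M` for every `|y| < a` (with these line functions
integrable); assume moreover the polynomial decay `w(x) = O(|x|^{-b})`, `b > 1`, on the real axis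
(an extra hypothesis used to invoke Poisson summation, see the module docstring).  Then for every
`h > 0`, `‖h Σ_{k ∈ ℤ} w(kh) - ∫_ℝ w‖ ≤ 2M / (e^{2πa/h} - 1)`.
[cite: TrefethenWeideman2014, Thm. 5.1] -/
theorem norm_tsum_sub_integral_le_of_strip {w : ℂ → ℂ} {a M h b : ℝ} (ha : 0 < a)
    (hh : 0 < h) (hw : DifferentiableOn ℂ w {z : ℂ | |z.im| < a})
    (hint : ∀ y : ℝ, |y| < a → Integrable fun x : ℝ => w (x + y * I))
    (hM : ∀ y : ℝ, |y| < a → ∫ x : ℝ, ‖w (x + y * I)‖ ≤ M)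
    (hvan : ∀ ε > 0, ∃ R : ℝ, ∀ z : ℂ, |z.im| < a → R ≤ |z.re| → ‖w z‖ ≤ ε)
    (hb : 1 < b) (hdec : (fun x : ℝ => w x) =O[cocompact ℝ] fun x : ℝ => |x| ^ (-b)) :
    ‖(h : ℂ) * ∑' k : ℤ, w (k * h) - ∫ x : ℝ, w x‖ ≤ 2 * M / (Real.exp (2 * π * a / h) - 1) := by
  have h0 : Integrable fun x : ℝ => w x := by simpa using hint 0 (by simpa using ha)
  have hM0 : 0 ≤ M :=
    le_trans (integral_nonneg fun x => norm_nonneg _) (by simpa using hM 0 (by simpa using ha))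
  -- it suffices to prove the bound with any `a' ∈ (0, a)` in place of `a`
  suffices key : ∀ a' : ℝ, 0 < a' → a' < a →
      ‖(h : ℂ) * ∑' k : ℤ, w (k * h) - ∫ x : ℝ, w x‖ ≤ 2 * M / (Real.exp (2 * π * a' / h) - 1) by
    have hden : Real.exp (2 * π * a / h) - 1 ≠ 0 := by
      have : 1 < Real.exp (2 * π * a / h) := Real.one_lt_exp_iff.mpr (by positivity)
      linarith
    have hcont : ContinuousAt (fun a' : ℝ => 2 * M / (Real.exp (2 * π * a' / h) - 1)) a :=
      ContinuousAt.div continuousAt_const (by fun_prop) hden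
    refine ge_of_tendsto (hcont.tendsto.mono_left (nhdsWithin_le_nhds (s := Iio a))) ?_
    filter_upwards [Ioo_mem_nhdsLT ha] with a' ha' using key a' ha'.1 ha'.2
  intro a' ha'0 ha'
  set wR : ℝ → ℂ := fun x => w x with hwR
  -- ### Step 1: exponential decay of the Fourier transform (Paley–Wiener, by the line shift)
  have hdecay : ∀ ξ : ℝ, ‖𝓕 wR ξ‖ ≤ M * Real.exp (-(2 * π * a' * |ξ|)) := by
    intro ξ
    have main : ∀ c : ℝ, |c| < a → 2 * π * c * ξ = -(2 * π * a' * |ξ|) →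
        ‖𝓕 wR ξ‖ ≤ M * Real.exp (-(2 * π * a' * |ξ|)) := by
      intro c hc hexp
      have h := norm_fourier_le_exp_mul_integral hc hw h0 (hint c hc) hvan ξ
      rw [hexp] at h
      calc ‖𝓕 wR ξ‖ ≤ Real.exp (-(2 * π * a' * |ξ|)) * ∫ x : ℝ, ‖w (x + c * I)‖ := h
        _ ≤ Real.exp (-(2 * π * a' * |ξ|)) * M :=
            mul_le_mul_of_nonneg_left (hM c hc) (Real.exp_pos _).le
        _ = M * Real.exp (-(2 * π * a' * |ξ|)) := mul_comm _ _
    rcases le_or_gt 0 ξ with hξ | hξ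
    · refine main (-a') (by rw [abs_neg, abs_of_nonneg ha'0.le]; exact ha') ?_
      rw [abs_of_nonneg hξ]; ring
    · refine main a' (by rw [abs_of_nonneg ha'0.le]; exact ha') ?_
      rw [abs_of_neg hξ]; ring
  -- ### Step 2: the rescaled function `f(x) = h w(xh)` and Poisson summation
  set f : ℝ → ℂ := fun x => (h : ℂ) * wR (x * h) with hf
  have hfc : Continuous f := by
    have hc : Continuous wR :=
      hw.continuousOn.comp_continuous continuous_ofReal fun x => by simpa using ha
    exact continuous_const.mul (hc.comp (by fun_prop))
  have hfO : f =O[cocompact ℝ] fun x : ℝ => |x| ^ (-b) := by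
    have ht : Tendsto (fun x : ℝ => x * h) (cocompact ℝ) (cocompact ℝ) :=
      Filter.tendsto_cocompact_mul_right (mul_inv_cancel₀ hh.ne')
    have h1 : (fun x : ℝ => wR (x * h)) =O[cocompact ℝ] fun x : ℝ => |x * h| ^ (-b) :=
      hdec.comp_tendsto ht
    have h2 : (fun x : ℝ => |x * h| ^ (-b)) =O[cocompact ℝ] fun x : ℝ => |x| ^ (-b) := by
      refine IsBigO.of_bound (|h| ^ (-b)) (Eventually.of_forall fun x => ?_)
      rw [Real.norm_of_nonneg (by positivity), Real.norm_of_nonneg (by positivity), abs_mul,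
        Real.mul_rpow (abs_nonneg _) (abs_nonneg _), mul_comm]
    have h3 := (h1.trans h2).const_mul_left (h : ℂ)
    exact h3
  have hFf : ∀ n : ℤ, 𝓕 f n = 𝓕 wR (n / h) := by
    intro n
    rw [hf, fourier_mul_comp_mul wR hh, mul_one, div_eq_mul_inv]
  -- the majorant as a geometric sequence
  set q : ℝ := Real.exp (-(2 * π * a' / h)) with hq
  have hq0 : 0 < q := Real.exp_pos _
  have hq1 : q < 1 := Real.exp_lt_one_iff.mpr (by
    have : 0 < 2 * π * a' / h := by positivity
    linarith)
  have hexpq : ∀ k : ℕ, Real.exp (-(2 * π * a' * k / h)) = q ^ k := by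
    intro k
    rw [hq, ← Real.exp_nat_mul]
    congr 1
    ring
  set c : ℤ → ℂ := fun n => 𝓕 wR (n / h) with hc
  have hnorm' : ∀ n : ℤ, ‖c n‖ ≤ M * q ^ n.natAbs := by
    intro n
    have habs : ((n.natAbs : ℕ) : ℝ) = |(n : ℝ)| := by
      rw [← Int.cast_natCast, Int.natCast_natAbs, Int.cast_abs]
    rw [← hexpq, habs]
    have e : -(2 * π * a' * |(n : ℝ)| / h) = -(2 * π * a' * |(n : ℝ) / h|) := by
      rw [abs_div, abs_of_pos hh]; ring
    rw [e]
    exact hdecay _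
  have hsumq : Summable fun n : ℤ => M * q ^ n.natAbs := by
    refine Summable.of_add_one_of_neg_add_one ?_ ?_
    · have : (fun n : ℕ => M * q ^ ((n : ℤ) + 1).natAbs) = fun n : ℕ => M * q ^ (n + 1) := by
        funext n
        rw [show ((n : ℤ) + 1).natAbs = n + 1 by omega]
      rw [this]
      exact ((summable_geometric_of_lt_one hq0.le hq1).mul_left (M * q)).congr
        fun n => by ring
    · have : (fun n : ℕ => M * q ^ (-((n : ℤ) + 1)).natAbs) = fun n : ℕ => M * q ^ (n + 1) := by
        funext n
        rw [show (-((n : ℤ) + 1)).natAbs = n + 1 by omega]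
      rw [this]
      exact ((summable_geometric_of_lt_one hq0.le hq1).mul_left (M * q)).congr
        fun n => by ring
  have hsumc : Summable c := Summable.of_norm_bounded hsumq hnorm'
  have hsumFf : Summable fun n : ℤ => 𝓕 f n := by
    refine hsumc.congr fun n => ?_
    rw [hc]; exact (hFf n).symm
  -- Poisson summation at `x = 0`
  have hPSF := Real.tsum_eq_tsum_fourier_of_rpow_decay_of_summable hfc hb hfO hsumFf 0
  have hlhs : ∑' n : ℤ, f (0 + n) = (h : ℂ) * ∑' k : ℤ, w (k * h) := by
    simp only [zero_add, hf, hwR, ofReal_mul, ofReal_intCast]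
    exact tsum_mul_left
  have hrhs : ∑' n : ℤ, 𝓕 f n * fourier n ((0 : ℝ) : UnitAddCircle) = ∑' n : ℤ, c n := by
    refine tsum_congr fun n => ?_
    rw [hFf n, hc]
    simp
  rw [hlhs, hrhs] at hPSF
  -- ### Step 3: split off `n = 0` (`= ∫ w`) and bound the two tails
  have htail : ∀ m : ℕ,
      ‖c ((m : ℤ) + 1)‖ ≤ M * q ^ (m + 1) ∧ ‖c (-((m : ℤ) + 1))‖ ≤ M * q ^ (m + 1) := by
    intro m
    constructor
    · refine (hnorm' _).trans (le_of_eq ?_)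
      rw [show ((m : ℤ) + 1).natAbs = m + 1 by omega]
    · refine (hnorm' _).trans (le_of_eq ?_)
      rw [show (-((m : ℤ) + 1)).natAbs = m + 1 by omega]
  have hgeo : HasSum (fun m : ℕ => M * q ^ (m + 1)) (M * q / (1 - q)) := by
    have h1 := (hasSum_geometric_of_lt_one hq0.le hq1).mul_left (M * q)
    have e1 : (fun m : ℕ => M * q ^ (m + 1)) = fun m : ℕ => M * q * q ^ m := by
      funext m
      ring
    rw [e1, div_eq_mul_inv]
    exact h1
  have hA : Summable fun m : ℕ => c ((m : ℤ) + 1) :=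
    Summable.of_norm_bounded hgeo.summable fun m => (htail m).1
  have hB : Summable fun m : ℕ => c (-((m : ℤ) + 1)) :=
    Summable.of_norm_bounded hgeo.summable fun m => (htail m).2
  have hAle : ‖∑' m : ℕ, c ((m : ℤ) + 1)‖ ≤ M * q / (1 - q) :=
    tsum_of_norm_bounded hgeo fun m => (htail m).1
  have hBle : ‖∑' m : ℕ, c (-((m : ℤ) + 1))‖ ≤ M * q / (1 - q) :=
    tsum_of_norm_bounded hgeo fun m => (htail m).2
  have hsplit := HasSum.of_add_one_of_neg_add_one hA.hasSum hB.hasSum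
  have hval : ∑' n : ℤ, c n =
      (∑' m : ℕ, c ((m : ℤ) + 1)) + c 0 + ∑' m : ℕ, c (-((m : ℤ) + 1)) := hsplit.tsum_eq
  have hc0 : c 0 = ∫ x : ℝ, w x := by
    simp only [hc, Int.cast_zero, zero_div]
    rw [Real.fourier_real_eq_integral_exp_smul]
    refine integral_congr_ae (Eventually.of_forall fun x => ?_)
    simp [hwR]
  have hE : (h : ℂ) * ∑' k : ℤ, w (k * h) - ∫ x : ℝ, w x =
      (∑' m : ℕ, c ((m : ℤ) + 1)) + ∑' m : ℕ, c (-((m : ℤ) + 1)) := by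
    rw [hPSF, hval, hc0]; ring
  have hrat : q / (1 - q) = 1 / (Real.exp (2 * π * a' / h) - 1) := by
    have hq' : q = (Real.exp (2 * π * a' / h))⁻¹ := by
      rw [hq, Real.exp_neg]
    have hne : Real.exp (2 * π * a' / h) - 1 ≠ 0 := by
      have : 1 < Real.exp (2 * π * a' / h) := Real.one_lt_exp_iff.mpr (by positivity)
      linarith
    rw [hq']
    field_simp
  rw [hE]
  calc ‖(∑' m : ℕ, c ((m : ℤ) + 1)) + ∑' m : ℕ, c (-((m : ℤ) + 1))‖
      ≤ M * q / (1 - q) + M * q / (1 - q) := (norm_add_le _ _).trans (add_le_add hAle hBle)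
    _ = 2 * M * (q / (1 - q)) := by ring
    _ = 2 * M / (Real.exp (2 * π * a' / h) - 1) := by rw [hrat]; ring

end Literature.Analysis.Quadrature
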